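import Mathlib
import HarnessLib
import Literature.Analysis.FluidPDE.ElgindiBlowup
import Literature.Analysis.FluidPDE.ParabolicComparison
import Literature.Analysis.UnboundedOperators.HeatKernelHeatEquation
import Literature.Analysis.UnboundedOperators.HeatKernelBoundedData
import Literature.Analysis.UnboundedOperators.HeatExtensionHarnack
import Summits.NavierStokesRegularity.NavierStokesRegularity.Theorems.HalfSpaceWindowDoorCirculationCarryingRigidityGaussExtremalFamily

/-!
# Route `HalfSpaceWindowDoor`, crux `CirculationCarryingRigidity` (stmt-NavierStokesRegularity-25311) —
# the FIRST-ORDER SYSTEM at the Gaussian-extremal point, in heat-semigroup form (numbers for the disprover)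

LEAD ns-hsw-p1 g7 (cell pub-ns-dss), `--supports stmt-NavierStokesRegularity-25311 --as helper`; sequel of `…GaussExtremal` (p668297)
and `…GaussExtremalFamily`.  By the Gaussian Kelvin–Stokes identity (`integral_G_angMom_eq`) the Gaussian axial angular momentum of a
door-class slice is a heat-smoothed vertical vorticity: `𝒢(t; x₀)[v(s)] = (4π)^{3/2}·2t·(e^{tΔ}ω₃(s))(x₀)`
(`gaussAngMom_eq_heatExtension`).  Reading the full-family normal form `exists_gaussExtremal'` through it gives, for the extremal profile
`W` and `Θ := e^{tΔ}ω₃^W(−1)` (`ω₃^W(−1) = ⟪curl W(−1), e₃⟫`):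

* `gaussExtremal_conditions` — **THE FIRST-ORDER SYSTEM.**  If W6 fails at constant `C`, there is a closed-hemisphere door-class `W`
  (constant `C`) with
  (E0) `Θ(1,0) > 0`;
  (E1) AXIS MAXIMALITY `Θ(1, y) ≤ Θ(1, 0)` for all `y ∈ ℝ³`, hence `ΔΘ(1,·)(0) ≤ 0` (`IsLocalMax.laplacian_nonpos`);
  (E2) SCALE MAXIMALITY `t·Θ(t,0) ≤ Θ(1,0)` for `0 < t ≤ 1`, hence `Θ(1,0) + ΔΘ(1,·)(0) ≥ 0` (one-sided Fermat at the right end-point of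
       `(0,1]` on `t ↦ t·e^{tΔ}ω₃(0)`, heat equation `∂_t e^{tΔ}ω₃ = Δ e^{tΔ}ω₃`);
  (E3) MAXIMAL INFLOW `ℐ(1;0)[W(−1)] = −2·(4π)^{3/2}·2·Θ(1,0)`.
  So `−Θ(1,0) ≤ ΔΘ(1,·)(0) ≤ 0`: at the extremal axis and scale the heat-smoothed vertical vorticity is spatially maximal but at most
  critically concave.  (Since `Δ e^{tΔ}ω₃ = ∂_t e^{tΔ}ω₃ = ∫(‖x‖²/4t² − 3/2t)G_t ω₃`, this is `2 ≤ ⟨‖x‖²⟩_{G₁ω₃} ≤ 6` — the `ω₃`-weighted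
  Gaussian second moment lies between that of a thin straight vortex column (`2`, all from `x₃`) and that of the free Gaussian (`6`);
  this reformulation is not typed here.)
* `hemisphereLiouvilleE3_of_firstOrderSystem` — the corresponding reduction: W6 follows if no closed-hemisphere door-class profile
  satisfies (E0)–(E3).

WHAT THIS IS NOT: not a statement about Navier–Stokes regularity; door statements concern HYPOTHETICAL blow-up profiles.  No item is
closed by this file.
-/

noncomputable section

-- the summit and its single sub-problem share the name (CONVENTIONS §1), as in every Theorems file
set_option linter.dupNamespace false

namespace Summit.NavierStokesRegularity.NavierStokesRegularity.Theorems.HalfSpaceWindowDoorCirculationCarryingRigidityGaussExtremalConditions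

open MeasureTheory Set Function Filter Topology
open scoped RealInnerProductSpace InnerProductSpace Laplacian
open Literature.Analysis Literature.Analysis.FluidPDE Literature.Analysis.UnboundedOperators
open Summit.NavierStokesRegularity.NavierStokesRegularity.Theses.HalfSpaceWindowDoor
open Summit.NavierStokesRegularity.NavierStokesRegularity.Theorems.HalfSpaceWindowDoorCirculationCarryingRigidityDefs
open Summit.NavierStokesRegularity.NavierStokesRegularity.Theorems.HalfSpaceWindowDoorCirculationCarryingRigidityReduction
  (circulationCarryingRigidity_of_hemisphereLiouvilleE3)
open Summit.NavierStokesRegularity.NavierStokesRegularity.Theorems.HalfSpaceWindowDoorCirculationCarryingRigidityGaussKernel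
  (gauss_eq_heatKernel rpow_scale inner_e3_apply)
open Summit.NavierStokesRegularity.NavierStokesRegularity.Theorems.HalfSpaceWindowDoorCirculationCarryingRigidityGaussCirculation
  (integral_G_angMom_eq)
open Summit.NavierStokesRegularity.NavierStokesRegularity.Theorems.HalfSpaceWindowDoorCirculationCarryingRigidityCriticalStretchingAnalytic
  (analyticOnNhd_inner_curl_e3_slice)
open Summit.NavierStokesRegularity.NavierStokesRegularity.Theorems.LocalSineTubeDoorProfileAlignedWindowRigidityAncient
  (bdd_of_hasTypeITimeDecay analyticOnNhd_slice)
open Summit.NavierStokesRegularity.NavierStokesRegularity.Theorems.PoloidalWindowDoorPoloidalWindowRigidityClassSpaceTimeRates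
  (exists_fderiv_rate_of_class')
open Summit.NavierStokesRegularity.NavierStokesRegularity.Theorems.HalfSpaceWindowDoorCirculationCarryingRigidityGaussExtremalFamily
  (exists_gaussExtremal')

variable {C : ℝ}

/-- The heat kernel is even: `G_t(x₀ − z) = G_t(z − x₀)`. -/
theorem heatKernel_sub_comm (t : ℝ) (x₀ z : EuclideanSpace ℝ (Fin 3)) : heatKernel t (x₀ - z) = heatKernel t (z - x₀) := by
  unfold heatKernel; rw [norm_sub_rev]

/-- **Gaussian angular momentum = heat-smoothed vertical vorticity.**  For a door-class profile, `s < 0`, `t > 0`, `x₀`: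
`𝒢(t; x₀)[v(s)] = (4π)^{3/2}·(2t)·(e^{tΔ}ω₃(s))(x₀)`, `ω₃(s) = ⟪curl v(s), e₃⟫` (Gaussian Kelvin–Stokes `integral_G_angMom_eq` + the
normalisation `e^{−‖y‖²/4t} = (4πt)^{3/2}G_t(y)`). -/
theorem gaussAngMom_eq_heatExtension {v : ℝ → EuclideanSpace ℝ (Fin 3) → EuclideanSpace ℝ (Fin 3)} (hv : InDoorClass C v)
    {s : ℝ} (hs : s < 0) {t : ℝ} (ht : 0 < t) (x₀ : EuclideanSpace ℝ (Fin 3)) :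
    gaussAngMom t x₀ (v s) =
      (4 * Real.pi) ^ ((3 : ℝ) / 2) * (2 * t) * heatExtension (fun x => ⟪curl (v s) x, e3⟫) t x₀ := by
  obtain ⟨hrate, hcont, hmild, -⟩ := hv
  obtain ⟨K₁, -, hK₁⟩ := exists_fderiv_rate_of_class' hrate hcont hmild
  have hA : AnalyticOnNhd ℝ (v s) univ := analyticOnNhd_slice hcont (bdd_of_hasTypeITimeDecay hrate) hmild hs
  have hVd : Differentiable ℝ (v s) := fun x => (hA x (mem_univ x)).differentiableAt
  have hVc : Continuous (fderiv ℝ (v s)) := continuousOn_univ.1 hA.fderiv.continuousOn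
  have hB : ∀ x, ‖v s x‖ ≤ C / Real.sqrt (-s) := fun x => hrate s hs x
  have hM : ∀ x, ‖fderiv ℝ (v s) x‖ ≤ K₁ / (-s) := hK₁ s hs
  have hid := integral_G_angMom_eq hVd hVc hB hM ht x₀
  have hgauss : (fun x => gauss t x₀ x * angMom x₀ (v s) x) = fun x =>
      (4 * Real.pi * t) ^ ((3 : ℝ) / 2) * (heatKernel t (x - x₀) * angMom x₀ (v s) x) := by
    funext x; rw [gauss_eq_heatKernel ht]; ring
  have hheat : heatExtension (fun x => ⟪curl (v s) x, e3⟫) t x₀ = ∫ x, heatKernel t (x - x₀) * curl (v s) x 2 := by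
    rw [heatExtension_eq_integral_mul]
    congr 1
    funext z
    rw [heatKernel_sub_comm, inner_e3_apply]
  unfold gaussAngMom
  rw [hgauss, integral_const_mul, hid, hheat]
  calc t ^ (-(3 : ℝ) / 2) * ((4 * Real.pi * t) ^ ((3 : ℝ) / 2) * (2 * t * ∫ x, heatKernel t (x - x₀) * curl (v s) x 2))
      = (t ^ (-(3 : ℝ) / 2) * (4 * Real.pi * t) ^ ((3 : ℝ) / 2)) * (2 * t) * ∫ x, heatKernel t (x - x₀) * curl (v s) x 2 := by ring
    _ = (4 * Real.pi) ^ ((3 : ℝ) / 2) * (2 * t) * ∫ x, heatKernel t (x - x₀) * curl (v s) x 2 := by rw [rpow_scale ht]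

/-- The `e₃`-vorticity slice of a door-class profile is continuous and bounded. -/
theorem omega3_continuous_bounded {v : ℝ → EuclideanSpace ℝ (Fin 3) → EuclideanSpace ℝ (Fin 3)} (hv : InDoorClass C v)
    {s : ℝ} (hs : s < 0) :
    Continuous (fun x => ⟪curl (v s) x, e3⟫) ∧ ∃ B : ℝ, ∀ x, ‖⟪curl (v s) x, e3⟫‖ ≤ B := by
  obtain ⟨hrate, hcont, hmild, -⟩ := hv
  refine ⟨continuousOn_univ.1 (analyticOnNhd_inner_curl_e3_slice hrate hcont hmild hs).continuousOn, ?_⟩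
  obtain ⟨K₁, -, hK₁⟩ := exists_fderiv_rate_of_class' hrate hcont hmild
  refine ⟨4 * (K₁ / (-s)), fun x => ?_⟩
  have he3 : ‖(e3 : EuclideanSpace ℝ (Fin 3))‖ = 1 := by simp [e3]
  calc ‖⟪curl (v s) x, e3⟫‖ ≤ ‖curl (v s) x‖ * ‖(e3 : EuclideanSpace ℝ (Fin 3))‖ := norm_inner_le_norm _ _
    _ = ‖curl (v s) x‖ := by rw [he3, mul_one]
    _ ≤ 4 * ‖fderiv ℝ (v s) x‖ := norm_curl_le_four_mul _ _
    _ ≤ 4 * (K₁ / (-s)) := by gcongr; exact hK₁ s hs x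

/-- **One-sided Fermat at a right end-point.**  If `G` has derivative `G'` at `1` and `G t ≤ G 1` for all `t ∈ (0, 1]`, then `0 ≤ G'`. -/
theorem deriv_nonneg_of_max_right {G : ℝ → ℝ} {G' : ℝ} (hG : HasDerivAt G G' 1) (hmax : ∀ t : ℝ, 0 < t → t ≤ 1 → G t ≤ G 1) :
    0 ≤ G' := by
  have hloc : IsLocalMaxOn G (Iic 1) 1 := by
    have hnhds : Ioi (0 : ℝ) ∈ 𝓝[Iic (1 : ℝ)] 1 := mem_nhdsWithin_of_mem_nhds (Ioi_mem_nhds (by norm_num))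
    filter_upwards [hnhds, self_mem_nhdsWithin] with t ht ht1
    exact hmax t ht ht1
  have hy : (-1 : ℝ) ∈ posTangentConeAt (Iic (1 : ℝ)) 1 := by
    refine mem_posTangentConeAt_of_segment_subset ?_
    rw [show (1 : ℝ) + -1 = 0 by norm_num, segment_symm, segment_eq_Icc (by norm_num : (0 : ℝ) ≤ 1)]
    exact Icc_subset_Iic_self
  have h := hloc.hasFDerivWithinAt_nonpos hG.hasFDerivAt.hasFDerivWithinAt hy
  simp at h
  linarith

/-- **THE FIRST-ORDER SYSTEM at the Gaussian-extremal point** (module docstring, (E0)–(E3)).  If some closed-hemisphere door-class profile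
(Type-I constant `C`) has `⟪curl v(s₁)(y₁), e₃⟫ > 0` somewhere, there is a closed-hemisphere door-class `W` (constant `C`) such that, with
`ω := ⟪curl W(−1), e₃⟫` and `Θ(t,·) := e^{tΔ}ω`: `Θ(1,0) > 0`; `Θ(1,y) ≤ Θ(1,0)` for all `y`; `t·Θ(t,0) ≤ Θ(1,0)` for `0 < t ≤ 1`;
`ΔΘ(1,·)(0) ≤ 0`; `Θ(1,0) + ΔΘ(1,·)(0) ≥ 0`; and `ℐ(1;0)[W(−1)] = −2·(4π)^{3/2}·2·Θ(1,0)`. -/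
theorem gaussExtremal_conditions {v : ℝ → EuclideanSpace ℝ (Fin 3) → EuclideanSpace ℝ (Fin 3)} (hv : InDoorClass C v)
    (hsign : SignE3 v) (hpos : ∃ s < 0, ∃ y, 0 < ⟪curl (v s) y, e3⟫) :
    ∃ W : ℝ → EuclideanSpace ℝ (Fin 3) → EuclideanSpace ℝ (Fin 3), InDoorClass C W ∧ SignE3 W ∧
      0 < heatExtension (fun x => ⟪curl (W (-1)) x, e3⟫) 1 0 ∧
      (∀ y, heatExtension (fun x => ⟪curl (W (-1)) x, e3⟫) 1 y ≤ heatExtension (fun x => ⟪curl (W (-1)) x, e3⟫) 1 0) ∧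
      (∀ t : ℝ, 0 < t → t ≤ 1 →
        t * heatExtension (fun x => ⟪curl (W (-1)) x, e3⟫) t 0 ≤ heatExtension (fun x => ⟪curl (W (-1)) x, e3⟫) 1 0) ∧
      (Δ (heatExtension (fun x => ⟪curl (W (-1)) x, e3⟫) 1)) 0 ≤ 0 ∧
      0 ≤ heatExtension (fun x => ⟪curl (W (-1)) x, e3⟫) 1 0 + (Δ (heatExtension (fun x => ⟪curl (W (-1)) x, e3⟫) 1)) 0 ∧
      gaussInflow 1 0 (W (-1)) =
        -2 * ((4 * Real.pi) ^ ((3 : ℝ) / 2) * 2 * heatExtension (fun x => ⟪curl (W (-1)) x, e3⟫) 1 0) := by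
  obtain ⟨W, hW, hWs, hΛ, hmax, hI⟩ := exists_gaussExtremal' hv hsign hpos
  set ω : EuclideanSpace ℝ (Fin 3) → ℝ := fun x => ⟪curl (W (-1)) x, e3⟫ with hω
  have hm1 : (-1 : ℝ) < 0 := by norm_num
  obtain ⟨hωc, B, hωB⟩ := omega3_continuous_bounded hW hm1
  -- the dictionary `𝒢 = c t Θ`
  set c : ℝ := (4 * Real.pi) ^ ((3 : ℝ) / 2) * 2 with hc
  have hc0 : 0 < c := by positivity
  have hdict : ∀ t : ℝ, 0 < t → ∀ y₀, gaussAngMom t y₀ (W (-1)) = c * t * heatExtension ω t y₀ := by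
    intro t ht y₀
    rw [gaussAngMom_eq_heatExtension hW hm1 ht y₀, hc]; ring
  -- (E0)
  have hΘpos : 0 < heatExtension ω 1 0 := by
    have h := hΛ
    rw [hdict 1 one_pos 0, mul_one] at h
    exact (mul_pos_iff_of_pos_left hc0).1 h
  -- (E1) axis maximality
  have haxis : ∀ y, heatExtension ω 1 y ≤ heatExtension ω 1 0 := by
    intro y
    have h := hmax (-1) hm1 1 one_pos (by norm_num) y
    rw [hdict 1 one_pos y, hdict 1 one_pos 0, mul_one] at h
    exact le_of_mul_le_mul_left h hc0
  -- (E2) scale maximality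
  have hscale : ∀ t : ℝ, 0 < t → t ≤ 1 → t * heatExtension ω t 0 ≤ heatExtension ω 1 0 := by
    intro t ht ht1
    have h := hmax (-1) hm1 t ht (by norm_num; exact ht1) 0
    rw [hdict t ht 0, hdict 1 one_pos 0, mul_one, mul_assoc] at h
    exact le_of_mul_le_mul_left h hc0
  -- Laplacian at the axis maximum
  have hC2 : ContDiff ℝ 2 (heatExtension ω 1) := contDiff_heatExtension_of_bound hωc hωB one_pos
  have hlocmax : IsLocalMax (heatExtension ω 1) 0 := Eventually.of_forall fun y => haxis y
  have hlap : (Δ (heatExtension ω 1)) 0 ≤ 0 := hlocmax.laplacian_nonpos hC2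
  -- one-sided Fermat in the scale
  have hderΘ : HasDerivAt (fun t => heatExtension ω t 0) ((Δ (heatExtension ω 1)) 0) 1 :=
    hasDerivAt_heatExtension_time one_pos (memLp_top_of_continuous_of_bound hωc hωB) le_top 0
  have hderG : HasDerivAt (fun t => t * heatExtension ω t 0)
      (1 * heatExtension ω 1 0 + 1 * (Δ (heatExtension ω 1)) 0) 1 := (hasDerivAt_id' (1 : ℝ)).mul hderΘ
  have hscale' : 0 ≤ 1 * heatExtension ω 1 0 + 1 * (Δ (heatExtension ω 1)) 0 := by
    refine deriv_nonneg_of_max_right hderG fun t ht ht1 => ?_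
    rw [one_mul]
    exact hscale t ht ht1
  rw [one_mul, one_mul] at hscale'
  -- (E3)
  have hI' : gaussInflow 1 0 (W (-1)) = -2 * (c * heatExtension ω 1 0) := by
    rw [hI, hdict 1 one_pos 0, mul_one]
  exact ⟨W, hW, hWs, hΘpos, haxis, hscale, hlap, hscale', hI'⟩

/-- **REDUCTION: W6 from the first-order system.**  If no closed-hemisphere door-class profile satisfies (E0)–(E3) at `(t, τ, y₀) = (1, −1, 0)`,
then `HemisphereLiouvilleE3` holds. -/
theorem hemisphereLiouvilleE3_of_firstOrderSystem
    (h : ∀ (C : ℝ) (W : ℝ → EuclideanSpace ℝ (Fin 3) → EuclideanSpace ℝ (Fin 3)), InDoorClass C W → SignE3 W →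
      0 < heatExtension (fun x => ⟪curl (W (-1)) x, e3⟫) 1 0 →
      (∀ y, heatExtension (fun x => ⟪curl (W (-1)) x, e3⟫) 1 y ≤ heatExtension (fun x => ⟪curl (W (-1)) x, e3⟫) 1 0) →
      (∀ t : ℝ, 0 < t → t ≤ 1 →
        t * heatExtension (fun x => ⟪curl (W (-1)) x, e3⟫) t 0 ≤ heatExtension (fun x => ⟪curl (W (-1)) x, e3⟫) 1 0) →
      (Δ (heatExtension (fun x => ⟪curl (W (-1)) x, e3⟫) 1)) 0 ≤ 0 →
      0 ≤ heatExtension (fun x => ⟪curl (W (-1)) x, e3⟫) 1 0 + (Δ (heatExtension (fun x => ⟪curl (W (-1)) x, e3⟫) 1)) 0 →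
      gaussInflow 1 0 (W (-1)) =
        -2 * ((4 * Real.pi) ^ ((3 : ℝ) / 2) * 2 * heatExtension (fun x => ⟪curl (W (-1)) x, e3⟫) 1 0) → False) :
    HemisphereLiouvilleE3 := by
  intro C v hrate hcont hmild hdiv hsign s hs y
  by_contra hne
  have hpos : 0 < ⟪curl (v s) y, e3⟫ := lt_of_le_of_ne (hsign s hs y) (Ne.symm hne)
  obtain ⟨W, hW, hWs, h0, h1, h2, h3, h4, h5⟩ :=
    gaussExtremal_conditions (C := C) ⟨hrate, hcont, hmild, hdiv⟩ hsign ⟨s, hs, y, hpos⟩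
  exact h C W hW hWs h0 h1 h2 h3 h4 h5

/-- **The crux from the first-order system** (composition with the landed plumbing `stub_rotate`). -/
theorem circulationCarryingRigidity_of_firstOrderSystem
    (h : ∀ (C : ℝ) (W : ℝ → EuclideanSpace ℝ (Fin 3) → EuclideanSpace ℝ (Fin 3)), InDoorClass C W → SignE3 W →
      0 < heatExtension (fun x => ⟪curl (W (-1)) x, e3⟫) 1 0 →
      (∀ y, heatExtension (fun x => ⟪curl (W (-1)) x, e3⟫) 1 y ≤ heatExtension (fun x => ⟪curl (W (-1)) x, e3⟫) 1 0) →
      (∀ t : ℝ, 0 < t → t ≤ 1 →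
        t * heatExtension (fun x => ⟪curl (W (-1)) x, e3⟫) t 0 ≤ heatExtension (fun x => ⟪curl (W (-1)) x, e3⟫) 1 0) →
      (Δ (heatExtension (fun x => ⟪curl (W (-1)) x, e3⟫) 1)) 0 ≤ 0 →
      0 ≤ heatExtension (fun x => ⟪curl (W (-1)) x, e3⟫) 1 0 + (Δ (heatExtension (fun x => ⟪curl (W (-1)) x, e3⟫) 1)) 0 →
      gaussInflow 1 0 (W (-1)) =
        -2 * ((4 * Real.pi) ^ ((3 : ℝ) / 2) * 2 * heatExtension (fun x => ⟪curl (W (-1)) x, e3⟫) 1 0) → False) :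
    CirculationCarryingRigidity :=
  circulationCarryingRigidity_of_hemisphereLiouvilleE3 (hemisphereLiouvilleE3_of_firstOrderSystem h)

end Summit.NavierStokesRegularity.NavierStokesRegularity.Theorems.HalfSpaceWindowDoorCirculationCarryingRigidityGaussExtremalConditions

end
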